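import Literature.NumberTheory.GelbartRogawski1991.DoubledUnitaryAdaptedRelations
import HarnessLib

/-!
# `Δ`-adapted block coordinates on `U(𝕍 ⊕ −𝕍)`, III: the determinant of a Siegel-parabolic element
# ([Kudla1994, §3]; [HarrisKudlaSweet1996, §1 (1.11)–(1.12)])

Topic `NumberTheory/GelbartRogawski1991`; namespace `Literature.NumberTheory.GelbartRogawski1991.AdaptedBlocks`
(sequel of `DoubledUnitaryAdaptedBlocks`, `DoubledUnitaryAdaptedRelations`).  KERNEL ONLY: proved lemmas over an
arbitrary commutative ring `L` with `2` invertible and a ring endomorphism `σ`; no named fact, no `sorry`.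

For `g ∈ U(σ, T ⊕ −T)` (`σ(g)ᵀ (T ⊕ −T) g = T ⊕ −T`) in the Siegel parabolic `P_Δ = {C = 0}` of the doubled space
(adapted blocks `adapt g = [[A, B], [0, D]]`, `A = g|_Δ = g₁₁ + g₁₂` — the tree's `deltaBlock` ∕ Kudla's `x(p)`):

* `det_adapt` — `det (adapt g) = det g` (`adapt g = R⁻¹ g R`);
* `det_eq_det_blkA_mul_det_blkD` — on `P_Δ`, `det g = det A · det D`;
* `map_det_blkD_mul_det_blkA` — the unitarity relation `Dᴴ T A = T` on `P_Δ` ([HarrisKudlaSweet1996, (1.11)]: `P_Δ` is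
  the stabiliser of the maximal isotropic subspace `Δ`, its Levi acts on `Δ` by `A` and on `Δ⁻ ≅ Δ^∨` by `D = (Aᴴ)⁻¹`
  up to `T`) gives `σ(det D) · det A = 1` (`T` invertible);
* **`det_mul_map_det_blkA`** — hence, for an INVOLUTION `σ`, `det g · σ(det A) = det A`, i.e.
  `det g = det A ∕ σ(det A)` = `x(p) ∕ x(p)‾` (over a field: `det_eq_det_blkA_div`);
* the same in the `toBlocks` language of the tree's `deltaBlock` ∕ `detDeltaM` (`A = g₁₁ + g₁₂` on `P_Δ`):
  `det_mul_map_det_deltaBlock`, and for a form RE-INDEXED along `e : ι ⊕ ι ≃ κ` (the tree's `e₂ : Fin n ⊕ Fin n ≃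
  Fin (n + n)`): `det_mul_map_det_deltaBlock_reindex`.

Used at the archimedean places of the kernel construction of [GelbartRogawski1991, Prop. 3.1.1] (stage-1 cell
`pub-hodgecm`, seat GR-3, input `stub_S1arch_twist`: `det g_w = σ_w(det α) ∕ σ_w(det α)‾` for `g` in `P_Δ(L ⊗ ℝ)`),
together with `CMSplittingCharArchComponents`.  Nothing here is a claim of the manuscripts adjudicated by that cell.

## References

* S. S. Kudla, *Splitting metaplectic covers of dual reductive pairs*, Israel J. Math. 87 (1994) 361–401, §3 (the
  Siegel parabolic of the doubled unitary group and `x(p) = det(p|_Δ)`) [Kudla1994].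
* M. Harris, S. S. Kudla, W. J. Sweet, J. Amer. Math. Soc. 9 (1996) 941–1004, §1 (1.11)–(1.12) (the doubled space
  `𝕍 ⊕ −𝕍`, `Δ`, `P_Δ` and its Levi factor) [HarrisKudlaSweet1996].
-/

set_option autoImplicit false

open Matrix

namespace Literature.NumberTheory.GelbartRogawski1991.AdaptedBlocks

variable {L : Type*} [CommRing L] {ι : Type*} [Fintype ι] [DecidableEq ι] [Invertible (2 : L)]

/-! ## §5 Determinants in the adapted frame -/

/-- `det R⁻¹ · det R = 1`. [cite: HarrisKudlaSweet1996, §1 (1.11)] -/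
private theorem det_cayRinv_mul_det_cayR : (cayRinv L ι).det * (cayR L ι).det = 1 := by
  rw [← Matrix.det_mul, cayRinv_mul_cayR, Matrix.det_one]

/-- **`det (adapt M) = det M`** (`adapt M = R⁻¹ M R`). [cite: HarrisKudlaSweet1996, §1 (1.11)] -/
theorem det_adapt (M : Matrix (ι ⊕ ι) (ι ⊕ ι) L) : (adapt M).det = M.det := by
  rw [adapt, Matrix.det_mul, Matrix.det_mul, mul_right_comm, det_cayRinv_mul_det_cayR, one_mul]

/-- **on `P_Δ = {C = 0}`, `det M = det A · det D`** (`adapt M = [[A, B], [0, D]]`). [cite: Kudla1994, §3] -/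
theorem det_eq_det_blkA_mul_det_blkD {M : Matrix (ι ⊕ ι) (ι ⊕ ι) L} (hC : blkC M = 0) :
    M.det = (blkA M).det * (blkD M).det := by
  rw [← det_adapt, adapt_eq, hC, Matrix.det_fromBlocks_zero₂₁]

variable {σ : L →+* L} {T : Matrix ι ι L}

/-- **`σ(det D) · det A = 1` on `P_Δ`**: determinant of the unitarity relation `Dᴴ T A + Bᴴ T C = T` (`rel₂₁`) at
`C = 0`, `T` invertible. [cite: HarrisKudlaSweet1996, §1 (1.11)–(1.12)] -/
theorem map_det_blkD_mul_det_blkA {M : Matrix (ι ⊕ ι) (ι ⊕ ι) L}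
    (hM : (M.map σ)ᵀ * Matrix.fromBlocks T 0 0 (-T) * M = Matrix.fromBlocks T 0 0 (-T)) (hC : blkC M = 0)
    (hT : IsUnit T.det) : σ (blkD M).det * (blkA M).det = 1 := by
  have h := rel₂₁ hM
  rw [hC, Matrix.mul_zero, add_zero] at h
  have hdet := congrArg Matrix.det h
  rw [Matrix.det_mul, Matrix.det_mul, Matrix.det_transpose, ← RingHom.mapMatrix_apply, ← RingHom.map_det] at hdet
  -- `σ(det D) · det T · det A = det T`; cancel the unit `det T`
  have h2 : σ (blkD M).det * (blkA M).det * T.det = 1 * T.det := by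
    rw [one_mul, mul_right_comm]; exact hdet
  exact hT.mul_right_cancel h2

/-- `det D · σ(det A) = 1` on `P_Δ`, for an involution `σ`. [cite: HarrisKudlaSweet1996, §1 (1.11)–(1.12)] -/
theorem det_blkD_mul_map_det_blkA {M : Matrix (ι ⊕ ι) (ι ⊕ ι) L}
    (hM : (M.map σ)ᵀ * Matrix.fromBlocks T 0 0 (-T) * M = Matrix.fromBlocks T 0 0 (-T)) (hC : blkC M = 0)
    (hT : IsUnit T.det) (hσ : ∀ x, σ (σ x) = x) : (blkD M).det * σ (blkA M).det = 1 := by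
  have h := congrArg σ (map_det_blkD_mul_det_blkA hM hC hT)
  rwa [map_mul, hσ, map_one] at h

/-- on `P_Δ`, `σ(det A)` is a unit (inverse `det D`). [cite: HarrisKudlaSweet1996, §1 (1.11)–(1.12)] -/
theorem isUnit_map_det_blkA {M : Matrix (ι ⊕ ι) (ι ⊕ ι) L}
    (hM : (M.map σ)ᵀ * Matrix.fromBlocks T 0 0 (-T) * M = Matrix.fromBlocks T 0 0 (-T)) (hC : blkC M = 0)
    (hT : IsUnit T.det) (hσ : ∀ x, σ (σ x) = x) : IsUnit (σ (blkA M).det) :=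
  IsUnit.of_mul_eq_one_right _ (det_blkD_mul_map_det_blkA hM hC hT hσ)

/-- **`det g · σ(det A) = det A` for `g ∈ P_Δ ⊂ U(σ, T ⊕ −T)`**, `A = g|_Δ`, `σ` an involution, `T` invertible:
the determinant of a Siegel-parabolic element of the doubled unitary group is `x(g) ∕ σ(x(g))`, `x(g) = det(g|_Δ)`.
[cite: Kudla1994, §3] [cite: HarrisKudlaSweet1996, §1 (1.11)–(1.12)] -/
theorem det_mul_map_det_blkA {M : Matrix (ι ⊕ ι) (ι ⊕ ι) L}
    (hM : (M.map σ)ᵀ * Matrix.fromBlocks T 0 0 (-T) * M = Matrix.fromBlocks T 0 0 (-T)) (hC : blkC M = 0)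
    (hT : IsUnit T.det) (hσ : ∀ x, σ (σ x) = x) : M.det * σ (blkA M).det = (blkA M).det := by
  rw [det_eq_det_blkA_mul_det_blkD hC, mul_assoc, det_blkD_mul_map_det_blkA hM hC hT hσ, mul_one]

/-- field form: **`det g = x(g) ∕ σ(x(g))`** on `P_Δ`. [cite: Kudla1994, §3] -/
theorem det_eq_det_blkA_div {K : Type*} [Field K] [Invertible (2 : K)] {σ : K →+* K} {T : Matrix ι ι K}
    {M : Matrix (ι ⊕ ι) (ι ⊕ ι) K}
    (hM : (M.map σ)ᵀ * Matrix.fromBlocks T 0 0 (-T) * M = Matrix.fromBlocks T 0 0 (-T)) (hC : blkC M = 0)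
    (hT : IsUnit T.det) (hσ : ∀ x, σ (σ x) = x) : M.det = (blkA M).det / σ (blkA M).det := by
  have hu := (isUnit_map_det_blkA hM hC hT hσ).ne_zero
  rw [eq_div_iff hu, det_mul_map_det_blkA hM hC hT hσ]

/-! ## §6 The same in the `toBlocks` language (`deltaBlock = M₁₁ + M₁₂` on `P_Δ`) -/

/-- **`det g · σ(det (g₁₁ + g₁₂)) = det (g₁₁ + g₁₂)`** for `g ∈ U(σ, T ⊕ −T)` with the Siegel relation
`g₁₁ + g₁₂ = g₂₁ + g₂₂` (the tree's `deltaBlock` ∕ `detDeltaM` language). [cite: Kudla1994, §3] -/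
theorem det_mul_map_det_deltaBlock {M : Matrix (ι ⊕ ι) (ι ⊕ ι) L}
    (hM : (M.map σ)ᵀ * Matrix.fromBlocks T 0 0 (-T) * M = Matrix.fromBlocks T 0 0 (-T))
    (hS : M.toBlocks₁₁ + M.toBlocks₁₂ = M.toBlocks₂₁ + M.toBlocks₂₂) (hT : IsUnit T.det) (hσ : ∀ x, σ (σ x) = x) :
    M.det * σ (M.toBlocks₁₁ + M.toBlocks₁₂).det = (M.toBlocks₁₁ + M.toBlocks₁₂).det := by
  have hC : blkC M = 0 := (blkC_eq_zero_iff M).2 hS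
  rw [← blkA_eq_of_blkC_eq_zero hC]
  exact det_mul_map_det_blkA hM hC hT hσ

omit [DecidableEq ι] [Invertible (2 : L)] in
/-- re-indexing `κ → ι ⊕ ι` along `e` is multiplicative (bookkeeping; Mathlib `submatrix_mul_equiv`).
[cite: HarrisKudlaSweet1996, §1 (1.11)] -/
private theorem reindex_symm_mul {κ : Type*} [Fintype κ] (e : ι ⊕ ι ≃ κ) (X Y : Matrix κ κ L) :
    Matrix.reindex e.symm e.symm (X * Y) = Matrix.reindex e.symm e.symm X * Matrix.reindex e.symm e.symm Y := by
  simp only [Matrix.reindex_apply, Equiv.symm_symm]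
  exact (Matrix.submatrix_mul_equiv X Y (⇑e) e (⇑e)).symm

/-- **re-indexed form.** For a form `H = e·(T ⊕ −T)·e` transported along `e : ι ⊕ ι ≃ κ` (the tree's
`e₂ : Fin n ⊕ Fin n ≃ Fin (n + n)`) and `g ∈ U(σ, H)` whose pull-back `e⁻¹ g e` satisfies the Siegel relation:
`det g · σ(det A) = det A` with `A = (e⁻¹ g e)₁₁ + (e⁻¹ g e)₁₂` (the tree's `detDeltaM`). [cite: Kudla1994, §3] -/
theorem det_mul_map_det_deltaBlock_reindex {κ : Type*} [Fintype κ] [DecidableEq κ] (e : ι ⊕ ι ≃ κ)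
    {M : Matrix κ κ L}
    (hM : (M.map σ)ᵀ * Matrix.reindex e e (Matrix.fromBlocks T 0 0 (-T)) * M =
      Matrix.reindex e e (Matrix.fromBlocks T 0 0 (-T)))
    (hS : (Matrix.reindex e.symm e.symm M).toBlocks₁₁ + (Matrix.reindex e.symm e.symm M).toBlocks₁₂ =
      (Matrix.reindex e.symm e.symm M).toBlocks₂₁ + (Matrix.reindex e.symm e.symm M).toBlocks₂₂)
    (hT : IsUnit T.det) (hσ : ∀ x, σ (σ x) = x) :
    M.det * σ ((Matrix.reindex e.symm e.symm M).toBlocks₁₁ + (Matrix.reindex e.symm e.symm M).toBlocks₁₂).det =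
      ((Matrix.reindex e.symm e.symm M).toBlocks₁₁ + (Matrix.reindex e.symm e.symm M).toBlocks₁₂).det := by
  have hdet : (Matrix.reindex e.symm e.symm M).det = M.det := Matrix.det_reindex_self e.symm M
  -- transport the unitarity relation along the ring isomorphism `reindex e.symm e.symm`
  have hF : Matrix.reindex e.symm e.symm (Matrix.reindex e e (Matrix.fromBlocks T 0 0 (-T))) =
      Matrix.fromBlocks T 0 0 (-T) := by
    rw [← Matrix.reindex_symm, Equiv.symm_apply_apply]
  have hTr : Matrix.reindex e.symm e.symm (M.map σ)ᵀ = ((Matrix.reindex e.symm e.symm M).map σ)ᵀ := by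
    rw [← Matrix.transpose_reindex]; rfl
  have hM' : ((Matrix.reindex e.symm e.symm M).map σ)ᵀ * Matrix.fromBlocks T 0 0 (-T) *
      Matrix.reindex e.symm e.symm M = Matrix.fromBlocks T 0 0 (-T) := by
    have h := congrArg (Matrix.reindex e.symm e.symm) hM
    rwa [reindex_symm_mul, reindex_symm_mul, hF, hTr] at h
  rw [← hdet]
  exact det_mul_map_det_deltaBlock hM' hS hT hσ

end Literature.NumberTheory.GelbartRogawski1991.AdaptedBlocks
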